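import Summits.BirchSwinnertonDyer.BirchSwinnertonDyer.Theorems.KolyvaginDepthDoorMSymbolCertPeriodsC
import Summits.BirchSwinnertonDyer.BirchSwinnertonDyer.Theorems.KolyvaginDepthDoorMSymbolCertKuriharaW
import HarnessLib

/-!
# Route `KolyvaginDepthDoor`, crux `KolyvaginDepthSupplyKN` (stmt-BirchSwinnertonDyer-22820) —
# DEPTH TABLE v28, KIT 4′ (composite level `N = q₁ q₂`): the Kurihara-number assembly on a certified line

Helper file of the lead prover of line `levelone` (kdd-p1 g33; `--supports stmt-BirchSwinnertonDyer-22820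
--as helper`); it closes nothing and BSD is NOT proved by it. Kit 4b's `exists_kuriharaNumber_ne_zero_w` VERBATIM on the
pair-indexed line of `…MSymbolCertCosetsC/PeriodsC`: certified line (`re [eC i]_f = t φ(i)` for all pair indices) +
inverse table + one `p`-adic unit value + admissible surjective logarithm tables + `kSum ≠ 0` ⟹ a surjective `ψ` with
`kuriharaNumber f p n ψ ≠ 0`, for `n` prime to the level `q₁ q₂`.

References: [Kim2022StructureSelmer] §1.4.3; [MazurTateTeitelbaum1986Invent] §I.8.
-/

set_option linter.dupNamespace false

noncomputable section

open scoped MatrixGroups ModularForm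
open CongruenceSubgroup
open Literature.NumberTheory.EllipticCurves Literature.NumberTheory.EllipticCurves.ModularForms

namespace Summit.BirchSwinnertonDyer.BirchSwinnertonDyer.Theorems.KolyvaginDepthDoor.MSymbolCert

section CPrime

variable {q₁ q₂ : ℕ} [h₁ : Fact q₁.Prime] [h₂ : Fact q₂.Prime] [hne : Fact (q₁ ≠ q₂)]
variable (f : CuspForm (Gamma0 (q₁ * q₂)) 2)

/-! ## §4 The Kurihara-number assembly at a composite level -/

/-- **ASSEMBLY (composite level)**: `f` the newform of `W` (globally minimal, `W[p]` irreducible, `p` odd) at level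
`q₁ q₂`; `n ≥ 1` prime to `q₁ q₂`; `re [eC i]_f = t φ(i)` for all pair indices (kits 1′–3′); an inverse table
`k · w(k) ≡ 1 (mod n)`; ONE `p`-adic unit value `S(a₀/n)`; admissible surjective logarithm tables; `kSum ≠ 0`.
Then `∃ ψ` (surjective at the primes of `n`) with `kuriharaNumber f p n ψ ≠ 0` (kit 4b VERBATIM on the composite line).
[cite: Kim2022StructureSelmer, §1.4.3] [cite: MazurTateTeitelbaum1986Invent, §I.8] -/
theorem exists_kuriharaNumber_ne_zero_wC (p : ℕ) [hp : Fact p.Prime] (n : ℕ) [NeZero n]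
    {W : WeierstrassCurve ℚ} [W.IsElliptic] [W.IsGloballyMinimal] (hf : IsNewformOf W f) (hp2 : p ≠ 2)
    (hirr : W.HasIrreducibleModPGaloisRep p) (hnN : n.Coprime (q₁ * q₂)) {φ : ℕ → ℤ} {t : ℝ}
    (hΨ : ∀ i < (q₁ + 1) * (q₂ + 1), ΨC f i = t * φ i)
    (w : ℕ → ℕ) (fuel : ℕ) (hfuel : n < fuel)
    (hw : ∀ k < n, Nat.Coprime k n → ((k : ℤ) * (w k : ℤ)) % n = 1)
    (a₀ : ℕ) (ha₀ : a₀ < n) (ha₀c : Nat.Coprime a₀ n)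
    (hunit : ¬ (p : ℤ) ∣ chainSumC q₁ q₂ φ fuel n (w a₀ : ℤ))
    (T : ℕ → List ℕ) (hT : ∀ ℓ, T ℓ = [] ∨ (ℓ.Prime ∧ tabOK ℓ p (T ℓ) = true))
    (hsurj : ∀ ℓ ∈ n.primeFactors, tabSurj ℓ p (T ℓ) = true)
    (hK : kSum p n (fun k => chainSumC q₁ q₂ φ fuel n (w k : ℤ)) n.primeFactors T ≠ 0) :
    ∃ ψ : (ℓ : ℕ) → (ZMod ℓ)ˣ →* Multiplicative (ZMod p),
      (∀ ℓ ∈ n.primeFactors, Function.Surjective (ψ ℓ)) ∧ kuriharaNumber f p n ψ ≠ 0 := by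
  have hf0 : IsNewform0 f := hf.1
  have hQ : coeffField f = ⊥ := hf.coeffField_eq_bot
  obtain ⟨g, ε, hg, hε, hval⟩ := exists_ratPlusSymbol_eqC f hf0 hQ hΨ
  have hn : 0 < n := Nat.pos_of_ne_zero (NeZero.ne n)
  have hsym : ∀ k < n, Nat.Coprime k n →
      ratPlusSymbol f ((k : ℚ) / n) = ε * chainSumC q₁ q₂ φ fuel n (w k : ℤ) / (2 * g) := by
    intro k hk hkc
    have := hval k (w k : ℤ) n hn (hw k hk hkc) fuel hfuel
    rwa [Int.cast_natCast] at this
  have h2g : ¬ p ∣ 2 * g := by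
    have hle : ‖((ratPlusSymbol f ((a₀ : ℚ) / n) : ℚ) : ℚ_[p])‖ ≤ 1 := by
      refine IsNewformOf.norm_ratPlusSymbol_le_one hf hp2 hirr ?_
      have hden : (((a₀ : ℚ) / n).den : ℤ) ∣ (n : ℤ) := by
        have := Rat.den_dvd (a₀ : ℤ) (n : ℤ)
        rwa [Rat.divInt_eq_div, Int.cast_natCast, Int.cast_natCast] at this
      have hden' : ((a₀ : ℚ) / n).den ∣ n := by exact_mod_cast hden
      exact Nat.Coprime.coprime_dvd_left hden' hnN
    rw [hsym a₀ ha₀ ha₀c] at hle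
    have := not_dvd_of_norm_div_le_one p ε _ (2 * g) (by omega) hε hunit (by push_cast at hle ⊢; exact hle)
    exact this
  refine ⟨tabFamily p T hT, fun ℓ hℓ => surjective_tabFamily p T hT (Nat.prime_of_mem_primeFactors hℓ) (hsurj ℓ hℓ), ?_⟩
  rw [kuriharaNumber_eq_unit_mul_kSum f p n T hT _ ε g h2g hsym]
  refine mul_ne_zero (div_ne_zero ?_ ?_) hK
  · rcases hε with rfl | rfl
    · simp
    · simp only [Int.reduceNeg, Int.cast_neg, Int.cast_one, ne_eq, neg_eq_zero]
      exact one_ne_zero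
  · rw [ne_eq, ZMod.natCast_eq_zero_iff]; exact h2g

end CPrime

end Summit.BirchSwinnertonDyer.BirchSwinnertonDyer.Theorems.KolyvaginDepthDoor.MSymbolCert

end
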